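/-
Copyright (c) 2026 the pub-hodgecm-mathlib formalisation cell (harness21).  Prover seat hodgecm-mathlib-K2E3-p05 (g2), Track B «K2-LIT», engine E3, unit U4 «Keys»,
2026-09-04.  KERNEL module: THEOREMS ONLY (no definition, no named fact, no `sorry`, no instance, no notation).
-/
import Summits.HodgeConjecture.HodgeConjecture.Theorems.K2E3IwahoriLevelDatum              -- ★-filed p856299 (this seat): the Iwahori datum at level `I` on the model at `w`
import Summits.HodgeConjecture.HodgeConjecture.Theorems.K2E3PSIwahoriBasis                 -- ★ II-1 (this seat's lineage): the (G3)-EXPLICIT letters; brings ★ PS-LEVELS, FILE C, ★ II-2a∕b vocabulary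
import Summits.HodgeConjecture.HodgeConjecture.Theorems.K2E3PSRegularReducibleCompZero     -- ★ p855058 (K2E3-p04): `normalizedJacquet_apply_eq_smul_of_finrank_eq_one_of_intertwiningMap_cmPrincipalSeries`; brings ★ N1 `_iff∕_holds`, ★ K5c apparatus
import Literature.NumberTheory.Automorphic.JacquetLemma                                    -- ★ Casselman Thm. 3.3.3: `JacquetLemma.fixedPoints_jacquetModule_le_map`
import Literature.NumberTheory.Automorphic.JacquetRankStrictMono                           -- ★ `Representation.finrank_coinvariants_eq_one_of_ne_bot_of_ne_top`
import Literature.NumberTheory.Automorphic.SmoothInductionAdmissibleOfCocompact             -- ★ `isAdmissible_cmPrincipalSeries_of_iwasawa`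
import Literature.NumberTheory.Automorphic.UnitaryGroupCMLocalIwasawa                      -- ★ `exists_borel_mul_mem_cmLocalIntegralLevel`
import Literature.NumberTheory.Automorphic.AdmissibleSubquotient                           -- ★ `IsAdmissible.toRepresentation`, `IsSmooth.toRepresentation`
import HarnessLib

/-!
# K2 ∕ E3 «EllipticInputs», unit U4 «Keys» — Road II of MEMO `hK-KeysThmTwo`, stub II-3 «IWAHORI DETECTION»: every `G`-stable `⊥ ≠ N ≠ ⊤` of an UNRAMIFIED principal
# series `i_G(χ)` of `U(Φ₃)(L⁺_v)` (`v` inert) contains a non-zero `I`-fixed vector  [Borel1976 §4 Lemma 4.7; Casselman1995 Thm. 3.3.3, Prop. 2.2.4; Casselman1980 §2]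

Cell hodgecm-mathlib (D-0151), FLOOR 0, Track B «K2-LIT», engine E3, crux item H413 = stmt-HodgeConjecture-24833 (route `HCCMUnconditional`, no route verbs); target BY NAME
`…K2E3EllipticInputs.U4Keys.sig_K2E3KeysThmTwoContracting` (U4-f), unramified first rung (Road II): the LINE hypothesis of ★ p855172 `criterion_of_iwahoriLine` wants
`N ∩ i_G(χ)^I ≠ 0` for the reducing subrepresentation `N`.  Author K2E3-p05 (g2).  `--supports stmt-HodgeConjecture-24833 --as helper`; THEOREMS ONLY; letters of ★ (G3)-EXPLICIT.

THE MATHEMATICS (Borel's lemma, the sub direction).  `V = i_G(χ)`, `χ = (χ₁, χ₂)` continuous and UNRAMIFIED (`χ ≡ 1` on `T ∩ K_v`), `v` non-split, `⊥ ≠ N ≠ ⊤` a `G`-stable subspace.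
(1) `r_B N` is a LINE (★ `finrank_coinvariants_eq_one_of_ne_bot_of_ne_top` over ★ N1 `dim r_B V = 2` and «no constituent has `r = 0`») on which `T` acts through `χ` (Frobenius, ★
`normalizedJacquet_apply_eq_smul_…_cmPrincipalSeries` fed with `N ↪ V`); (2) hence `T ∩ I` acts TRIVIALLY on `r_B N` (`χ = 1` there, and `δ_B^{1∕2} = 1` on the compact `I`), i.e.
`(r_B N)^{T ∩ I} = r_B N ≠ 0`; (3) JACQUET'S LEMMA at the Iwahori level (★ `JacquetLemma.fixedPoints_jacquetModule_le_map` for the datum ★-filed `exists_iwahoriDatum_iwahoriLevel`,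
pulled back to the CM carrier along `eA` by ★ `StructureTransport.exists_iwahoriDatum_comap`; §2 supplies `T′.comap eA = T`, `N′.comap eA = N` from `heA`) says `N^I ↠ (r_B N)^{T ∩ I}`,
so **`N^I ≠ 0`**: there is `0 ≠ u ∈ N ∩ V^I` — the vector `u` of ★ p855172's criterion.  (`N` is admissible: ★ `isAdmissible_cmPrincipalSeries_of_iwasawa` + ★ `IsAdmissible.toRepresentation`.)
§1 (abstract `G ⊇ P = MN`, any Iwahori datum) `exists_mem_fixedPoints_ne_zero_of_finrank_coinvariants_eq_one` · §2 (CM, (G3) letters) `eA_mem_torusU_iff`, `eA_mem_unipotentU_iff`,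
`exists_iwahoriDatum_K_zero_eq` (a datum for `cmBorelTriple L 3 v` with `K 0 = I`) · §3 `exists_ne_zero_mem_inf_fixedPoints_I` (the detection).
HONEST LABEL: HC_CM is proved only modulo the 7 printed citations (2 remaining named inputs: hLiu418 = stmt-HodgeConjecture-24832, h413 = stmt-HodgeConjecture-24833)
until rung 0 closes; count-neutral (a classical lemma made available in house; the quotient direction «`V^I ⊄ N`» and the assembly II-4 are the sequel).

## References
* [Borel1976] A. Borel, *Admissible representations of a semi-simple group over a local field with vectors fixed under an Iwahori subgroup*, Invent. Math. 35 (1976), §3–§4, Lemma 4.7.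
* [Casselman1995] W. Casselman, *Introduction to the theory of admissible representations of p-adic reductive groups* (1995), Prop. 2.2.4, Thm. 3.3.3, Prop. 7.1.3.
* [Casselman1980] W. Casselman, Compositio Math. 40 (1980), §2.  * [BernsteinZelevinsky1977] Ann. Sci. ÉNS 10 (1977), Prop. 1.9, §2.3.
-/

set_option autoImplicit false
-- the mandated namespace has the single-problem summit's repeated segment (`HodgeConjecture.HodgeConjecture`)
set_option linter.dupNamespace false

noncomputable section

open NumberField IsDedekindDomain MeasureTheory
open scoped Matrix MatrixGroups NNReal WithZero
open ValuativeRel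
open Literature.NumberTheory Literature.NumberTheory.Automorphic Literature.NumberTheory.Automorphic.UnitaryGroup
open Literature.NumberTheory.Rogawski1990 Literature.NumberTheory.GaloisRepresentations
open Literature.RepresentationTheory.FiniteGroups Literature.RepresentationTheory.Semisimple

namespace Summit.HodgeConjecture.HodgeConjecture.Cruxes.H413.K2E3IwahoriDetection

open Summit.HodgeConjecture.HodgeConjecture.Cruxes.H413
open Summit.HodgeConjecture.HodgeConjecture.Cruxes.H413.F0P3cStCharTSStLevelsTransport
open Summit.HodgeConjecture.HodgeConjecture.Cruxes.H413.K2E3IwahoriLevelDatum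
open Summit.HodgeConjecture.HodgeConjecture.Cruxes.H413.K2E3PSRegularReducibleCompZero
open F0P2pCmPrincipalSeriesInterface

universe u

/-! ## §1 Abstract: a Jacquet line fixed by `K ∩ M` is the image of a non-zero `K`-fixed vector -/

section Abstract

variable {G : Type u} [Group G] [TopologicalSpace G] [IsTopologicalGroup G] (t : ParabolicTriple G) (𝓘 : t.IwahoriDatum)

/-- **JACQUET'S LEMMA ON A FIXED LINE.**  For an admissible `π`, a `G`-stable `N` whose Jacquet module `r_P N` is a LINE on which every `m ∈ M ∩ K₀` (`K₀ = 𝓘.K 0`) acts trivially: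
`N` contains a NON-ZERO `K₀`-fixed vector (★ `JacquetLemma.fixedPoints_jacquetModule_le_map`: `N^{K₀} ↠ (r_P N)^{M ∩ K₀} = r_P N ∋ ξ ≠ 0`).
[cite: Casselman1995, Thm. 3.3.3] [cite: Borel1976, Lemma 4.7] -/
theorem exists_mem_fixedPoints_ne_zero_of_finrank_coinvariants_eq_one {V : Type*} [AddCommGroup V] [Module ℂ V]
    (π : Representation ℂ G V) (N : Subrepresentation π) (hadm : N.toRepresentation.IsAdmissible)
    (h1 : Module.finrank ℂ (t.restrict N.toRepresentation).Coinvariants = 1)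
    (hfix : ∀ m : ↥t.M, (m : G) ∈ 𝓘.K 0 → ∀ x : (t.restrict N.toRepresentation).Coinvariants, N.toRepresentation.jacquetModule t m x = x) :
    ∃ u : V, u ∈ N.toSubmodule ∧ u ∈ π.fixedPoints (𝓘.K 0) ∧ u ≠ 0 := by
  haveI : Nontrivial (t.restrict N.toRepresentation).Coinvariants := Module.nontrivial_of_finrank_eq_succ h1
  obtain ⟨ξ, hξ⟩ := exists_ne (0 : (t.restrict N.toRepresentation).Coinvariants)
  have hξfix : ξ ∈ (N.toRepresentation.jacquetModule t).fixedPoints ((𝓘.K 0).comap t.M.subtype) :=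
    (Representation.mem_fixedPoints _ _ _).2 fun m hm => hfix m (Subgroup.mem_comap.1 hm) ξ
  obtain ⟨y, hy, hyξ⟩ := JacquetLemma.fixedPoints_jacquetModule_le_map N.toRepresentation t 𝓘 hadm 0 hξfix
  have hy0 : y ≠ 0 := by
    rintro rfl
    exact hξ (by rw [← hyξ, map_zero])
  refine ⟨(y : V), y.2, (Representation.mem_fixedPoints _ _ _).2 fun k hk => ?_, fun h0 => hy0 (Subtype.ext h0)⟩
  have h := congrArg Subtype.val ((Representation.mem_fixedPoints _ _ _).1 hy k hk)
  exact h

/-- **Triviality of `M ∩ K` on a `χ`-line**: if `M` acts on `r_P N` through the character `χ` in the NORMALISED Jacquet module, `χ = 1` on `M ∩ K` and `δ_P^{1∕2} = 1` on `M ∩ K`, then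
`M ∩ K` acts trivially in the (unnormalised) Jacquet module (`r_P = r_P^{norm} ⊗ δ^{1∕2}`, ★ `Representation.twist_apply`). [cite: Casselman1995, §3.1, Prop. 7.1.3] -/
theorem jacquetModule_apply_eq_self_of_normalizedJacquet_eq_smul {W : Type*} [AddCommGroup W] [Module ℂ W] [LocallyCompactSpace ↥t.P]
    (ρ : Representation ℂ G W) (K : Subgroup G) (χ : ↥t.M →* ℂˣ)
    (hJ : ∀ (m : ↥t.M) (x : (t.restrict ρ).Coinvariants), ρ.normalizedJacquet t m x = ((χ m : ℂˣ) : ℂ) • x)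
    (hχ : ∀ m : ↥t.M, (m : G) ∈ K → χ m = 1)
    (hδ : ∀ m : ↥t.M, (m : G) ∈ K → rootDeltaChar t.P (Subgroup.inclusion t.M_le m) = 1) :
    ∀ m : ↥t.M, (m : G) ∈ K → ∀ x : (t.restrict ρ).Coinvariants, ρ.jacquetModule t m x = x := by
  intro m hm x
  have e : ρ.normalizedJacquet t m x = ((((rootDeltaChar t.P)⁻¹.comp (Subgroup.inclusion t.M_le)) m : ℂˣ) : ℂ) • ρ.jacquetModule t m x :=
    Representation.twist_apply _ _ _ _
  rw [hJ m x, hχ m hm, Units.val_one, one_smul, MonoidHom.comp_apply, MonoidHom.inv_apply, hδ m hm, inv_one, Units.val_one, one_smul] at e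
  exact e.symm

end Abstract

/-! ## §2 CM carrier: `T′.comap eA = T`, `N′.comap eA = N`, and an Iwahori datum for `cmBorelTriple L 3 v` with `K 0 = I` -/

section CM

variable (L : Type) [Field L] [NumberField L] [IsCMField L] (v : HeightOneSpectrum (𝓞 ↥(maximalRealSubfield L)))
  (w : PlacesOver L v) (hw : IsCMField.complexConj L • w.1 = w.1)
  (eA : Gqs L v ≃ₜ* ↥(unitaryGroupOfForm (galAdicCompletionMap (L := L) (IsCMField.complexConj L) hw) ((StdForm.antidiagonal 3).over (w.1.adicCompletion L))))
  (heA : ∀ g : Gqs L v,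
    ((eA g : ↥(unitaryGroupOfForm (galAdicCompletionMap (L := L) (IsCMField.complexConj L) hw) ((StdForm.antidiagonal 3).over (w.1.adicCompletion L)))) : GL (Fin 3) (w.1.adicCompletion L)) =
      ((localNonsplitEquiv (IsCMField.complexConj L) (qsForm L) (IsCMField.complexConj_ne_one L) w hw g :
        ↥(unitaryGroupOfForm (galAdicCompletionMap (L := L) (IsCMField.complexConj L) hw) (placeForm (qsForm L) w.1))) : GL (Fin 3) (w.1.adicCompletion L)))

include heA in
/-- **`eA` respects the tori**: `eA g ∈ T(L_w) ↔ g ∈ T(L⁺_v) = (cmBorelTriple L 3 v).M` — both say «the matrix is diagonal», and `eA g`, `localNonsplitEquiv g` have the same matrix (`heA`);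
★ `localNonsplitEquiv_mem_torusU_iff`. [cite: PlatonovRapinchuk1994, §5.1] [cite: Rogawski1990, §1.10 p. 9] -/
theorem eA_mem_torusU_iff (g : Gqs L v) :
    eA g ∈ torusU (galAdicCompletionMap (L := L) (IsCMField.complexConj L) hw) ((StdForm.antidiagonal 3).over (w.1.adicCompletion L)) ↔
      (g : ↥(unitaryGroupOfForm (conjLocal L (IsCMField.complexConj L) v) (cmLocalForm L 3 v))) ∈ (cmBorelTriple L 3 v).M := by
  constructor
  · intro h
    obtain ⟨d, hd'⟩ := (mem_torusU_iff _).1 h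
    exact (localNonsplitEquiv_mem_torusU_iff L v w hw g).1 ((mem_torusU_iff _).2 ⟨d, hd'.trans (heA g)⟩)
  · intro h
    obtain ⟨d, hd'⟩ := (mem_torusU_iff _).1 ((localNonsplitEquiv_mem_torusU_iff L v w hw g).2 h)
    exact (mem_torusU_iff _).2 ⟨d, hd'.trans (heA g).symm⟩

include heA in
/-- **`eA` respects the unipotent radicals**: `eA g ∈ N(L_w) ↔ g ∈ N(L⁺_v) = (cmBorelTriple L 3 v).N` (★ `localNonsplitEquiv_mem_unipotentU_iff` + `heA`).
[cite: PlatonovRapinchuk1994, §5.1] [cite: Rogawski1990, §1.10 p. 9] -/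
theorem eA_mem_unipotentU_iff (g : Gqs L v) :
    eA g ∈ unipotentU (galAdicCompletionMap (L := L) (IsCMField.complexConj L) hw) ((StdForm.antidiagonal 3).over (w.1.adicCompletion L)) ↔
      (g : ↥(unitaryGroupOfForm (conjLocal L (IsCMField.complexConj L) v) (cmLocalForm L 3 v))) ∈ (cmBorelTriple L 3 v).N := by
  constructor
  · intro h
    have h' := (mem_unipotentU_iff _).1 h
    rw [heA g] at h'
    exact (localNonsplitEquiv_mem_unipotentU_iff L v w hw g).1 ((mem_unipotentU_iff _).2 h')
  · intro h
    have h' := (mem_unipotentU_iff _).1 ((localNonsplitEquiv_mem_unipotentU_iff L v w hw g).2 h)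
    rw [← heA g] at h'
    exact (mem_unipotentU_iff _).2 h'

include heA in
set_option maxHeartbeats 1600000 in
-- the ray data and the transport clauses (class of ★ `F0P3CMBorelIwahoriDatum` §2)
/-- **An Iwahori datum for `cmBorelTriple L 3 v` WITH FIRST LEVEL `I`** (`v` inert, the (G3)-EXPLICIT levels): the model datum ★-filed `exists_iwahoriDatum_iwahoriLevel` along the ray
`d(ϖ, 1, (σϖ)⁻¹)` (★ `exists_coe_eq_diag`), pulled back along `eA` by ★ `StructureTransport.exists_iwahoriDatum_comap` (clauses `T′.comap eA = T`, `N′.comap eA = N` above).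
[cite: Casselman1995, Prop. 1.4.4, Thm. 3.3.3] [cite: PlatonovRapinchuk1994, §5.1] -/
theorem exists_iwahoriDatum_K_zero_eq {ϖ : w.1.adicCompletion L}
    (hd : HermitianLattice.UnramifiedLocalConjDatum (galAdicCompletionMap (L := L) (IsCMField.complexConj L) hw) ϖ)
    (g₁ : GL (Fin 3) (w.1.adicCompletion L)) (hg₁ : (g₁ : Matrix (Fin 3) (Fin 3) (w.1.adicCompletion L)) = Matrix.diagonal ![(1 : w.1.adicCompletion L), 1, ϖ])
    (K0 K1 I : Subgroup (Gqs L v))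
    (hK0 : K0 = ((glInt 3 (w.1.adicCompletion L)).subgroupOf
      (unitaryGroupOfForm (galAdicCompletionMap (L := L) (IsCMField.complexConj L) hw) ((StdForm.antidiagonal 3).over (w.1.adicCompletion L)))).comap
        eA.toMulEquiv.toMonoidHom)
    (hK1 : K1 = (((glInt 3 (w.1.adicCompletion L)).map (MulAut.conj g₁).toMonoidHom).subgroupOf
      (unitaryGroupOfForm (galAdicCompletionMap (L := L) (IsCMField.complexConj L) hw) ((StdForm.antidiagonal 3).over (w.1.adicCompletion L)))).comap
        eA.toMulEquiv.toMonoidHom)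
    (hI : I = K0 ⊓ K1) :
    ∃ 𝓘 : (cmBorelTriple L 3 v).IwahoriDatum, 𝓘.K 0 = I := by
  have hσσ := hd.σσ
  have hϖ0 : ϖ ≠ 0 := CartanUnique.uniformizer_ne_zero hd.vϖ
  have hσϖ0 : galAdicCompletionMap (L := L) (IsCMField.complexConj L) hw ϖ ≠ 0 := (map_ne_zero _).2 hϖ0
  -- the ray `s = d(ϖ, 1, (σϖ)⁻¹)` and its ratio data
  obtain ⟨s, -, hs⟩ := exists_coe_eq_diag (galAdicCompletionMap (L := L) (IsCMField.complexConj L) hw)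
    (rfl : (StdForm.antidiagonal 3).over (w.1.adicCompletion L) = _) hσσ hϖ0 (β := 1) (by rw [map_one, mul_one])
  have hvσϖ : valuation (w.1.adicCompletion L) (galAdicCompletionMap (L := L) (IsCMField.complexConj L) hw ϖ) = valuation (w.1.adicCompletion L) ϖ :=
    (v_eq_iff_valuation_eq _ _).1 (hd.vσ ϖ)
  have hq0 : valuation (w.1.adicCompletion L) ϖ ≠ 0 := (Valuation.ne_zero_iff _).2 hϖ0
  have hq1 : valuation (w.1.adicCompletion L) ϖ < 1 := by
    rw [← v_lt_one_iff_valuation_lt_one, hd.vϖ, ← WithZero.exp_zero, WithZero.exp_lt_exp]; norm_num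
  set u : Fin 3 → (w.1.adicCompletion L)ˣ := ![Units.mk0 ϖ hϖ0, 1, (Units.mk0 _ hσϖ0)⁻¹] with hu_def
  have hu0 : ((u 0 : (w.1.adicCompletion L)ˣ) : w.1.adicCompletion L) = ϖ := by simp only [hu_def, Matrix.cons_val_zero, Units.val_mk0]
  have hu1 : ((u 1 : (w.1.adicCompletion L)ˣ) : w.1.adicCompletion L) = 1 := by simp only [hu_def, Matrix.cons_val_one, Matrix.cons_val_zero, Units.val_one]
  have hu2 : ((u 2 : (w.1.adicCompletion L)ˣ) : w.1.adicCompletion L) = (galAdicCompletionMap (L := L) (IsCMField.complexConj L) hw ϖ)⁻¹ := by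
    simp only [hu_def, Matrix.cons_val_two, Matrix.tail_cons, Matrix.head_cons, Units.val_inv_eq_inv_val, Units.val_mk0]
  have hsu : ((s : ↥(unitaryGroupOfForm (galAdicCompletionMap (L := L) (IsCMField.complexConj L) hw) ((StdForm.antidiagonal 3).over (w.1.adicCompletion L)))) :
      GL (Fin 3) (w.1.adicCompletion L)) = glDiagonal 3 (w.1.adicCompletion L) u := by
    refine Units.ext ?_
    rw [hs, coe_glDiagonal]
    ext i j
    fin_cases i <;> fin_cases j <;> simp [hu0, hu1, hu2, Matrix.diagonal]
  have hu : ∀ i j : Fin 3, i < j → valuation (w.1.adicCompletion L) ((u i : w.1.adicCompletion L) * ((u j : w.1.adicCompletion L))⁻¹) ≤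
      valuation (w.1.adicCompletion L) ϖ := by
    intro i j hij
    fin_cases i <;> fin_cases j
    all_goals first | exact absurd hij (by decide) | skip
    · show valuation _ (((u 0 : (w.1.adicCompletion L)ˣ) : w.1.adicCompletion L) * (((u 1 : (w.1.adicCompletion L)ˣ) : w.1.adicCompletion L))⁻¹) ≤ _
      rw [hu0, hu1, inv_one, mul_one]
    · show valuation _ (((u 0 : (w.1.adicCompletion L)ˣ) : w.1.adicCompletion L) * (((u 2 : (w.1.adicCompletion L)ˣ) : w.1.adicCompletion L))⁻¹) ≤ _
      rw [hu0, hu2, inv_inv, map_mul, hvσϖ]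
      calc valuation _ ϖ * valuation _ ϖ ≤ valuation _ ϖ * 1 := mul_le_mul' le_rfl hq1.le
        _ = valuation _ ϖ := mul_one _
    · show valuation _ (((u 1 : (w.1.adicCompletion L)ˣ) : w.1.adicCompletion L) * (((u 2 : (w.1.adicCompletion L)ˣ) : w.1.adicCompletion L))⁻¹) ≤ _
      rw [hu1, hu2, inv_inv, one_mul, hvσϖ]
  -- the model datum at level `I`
  obtain ⟨𝓘', -, -, hK0', -⟩ := exists_iwahoriDatum_iwahoriLevel L v w hw hd g₁ hg₁ hq0 hq1 s u hsu hu
  -- the transport clauses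
  have hM : ((borelTriple (galAdicCompletionMap (L := L) (IsCMField.complexConj L) hw) ((StdForm.antidiagonal 3).over (w.1.adicCompletion L)) rfl).M).comap
      (eA : Gqs L v →* ↥(unitaryGroupOfForm (galAdicCompletionMap (L := L) (IsCMField.complexConj L) hw) ((StdForm.antidiagonal 3).over (w.1.adicCompletion L)))) =
      (cmBorelTriple L 3 v).M := by
    ext g
    rw [Subgroup.mem_comap, borelTriple_M]
    exact eA_mem_torusU_iff L v w hw eA heA g
  have hN : ((borelTriple (galAdicCompletionMap (L := L) (IsCMField.complexConj L) hw) ((StdForm.antidiagonal 3).over (w.1.adicCompletion L)) rfl).N).comap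
      (eA : Gqs L v →* ↥(unitaryGroupOfForm (galAdicCompletionMap (L := L) (IsCMField.complexConj L) hw) ((StdForm.antidiagonal 3).over (w.1.adicCompletion L)))) =
      (cmBorelTriple L 3 v).N := by
    ext g
    rw [Subgroup.mem_comap, borelTriple_N]
    exact eA_mem_unipotentU_iff L v w hw eA heA g
  obtain ⟨𝓘, -, -, hK⟩ := StructureTransport.exists_iwahoriDatum_comap eA (cmBorelTriple L 3 v)
    (borelTriple (galAdicCompletionMap (L := L) (IsCMField.complexConj L) hw) ((StdForm.antidiagonal 3).over (w.1.adicCompletion L)) rfl) hM hN 𝓘'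
  refine ⟨𝓘, ?_⟩
  rw [hK 0, hK0', hI, hK0, hK1, ← Subgroup.comap_inf]
  rfl

/-! ## §3 The detection -/

include heA in
set_option maxHeartbeats 8000000 in
set_option synthInstance.maxHeartbeats 400000 in
-- statement∕proof-heavy: the `SmoothInd` carrier of `cmPrincipalSeries`, ★ N1's datum and the Jacquet line of a subrepresentation (class of ★ p855058 §3)
/-- **IWAHORI DETECTION (Borel's lemma, sub direction) for the unramified principal series of `U(Φ₃)(L⁺_v)`, `v` inert.**  `χ = (χ₁, χ₂)` continuous and UNRAMIFIED (`χ ≡ 1` on `T ∩ K_v`),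
`⊥ ≠ N ≠ ⊤` a `G`-stable subspace of `V = i_G(χ)`: there is `0 ≠ u ∈ N` fixed by the Iwahori subgroup `I` — so `N ∩ V^I` is a non-zero subspace of the Iwahori plane `ℂ f₁ ⊕ ℂ f_w` (★ II-1).
Proof in the module docstring: `r_B N` is a `χ`-line, `T ∩ I` acts trivially on it, Jacquet's lemma at the level `I`. [cite: Borel1976, Lemma 4.7] [cite: Casselman1995, Thm. 3.3.3, Prop. 7.1.3]
[cite: Casselman1980, §2] [cite: BernsteinZelevinsky1977, Prop. 1.9 (b)] -/
theorem exists_ne_zero_mem_inf_fixedPoints_I (hns : ∀ w' : PlacesOver L v, IsCMField.complexConj L • w'.1 = w'.1) {ϖ : w.1.adicCompletion L}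
    (hd : HermitianLattice.UnramifiedLocalConjDatum (galAdicCompletionMap (L := L) (IsCMField.complexConj L) hw) ϖ)
    (g₁ : GL (Fin 3) (w.1.adicCompletion L)) (hg₁ : (g₁ : Matrix (Fin 3) (Fin 3) (w.1.adicCompletion L)) = Matrix.diagonal ![(1 : w.1.adicCompletion L), 1, ϖ])
    (K0 K1 I : Subgroup (Gqs L v))
    (hK0 : K0 = ((glInt 3 (w.1.adicCompletion L)).subgroupOf
      (unitaryGroupOfForm (galAdicCompletionMap (L := L) (IsCMField.complexConj L) hw) ((StdForm.antidiagonal 3).over (w.1.adicCompletion L)))).comap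
        eA.toMulEquiv.toMonoidHom)
    (hK1 : K1 = (((glInt 3 (w.1.adicCompletion L)).map (MulAut.conj g₁).toMonoidHom).subgroupOf
      (unitaryGroupOfForm (galAdicCompletionMap (L := L) (IsCMField.complexConj L) hw) ((StdForm.antidiagonal 3).over (w.1.adicCompletion L)))).comap
        eA.toMulEquiv.toMonoidHom)
    (hI : I = K0 ⊓ K1)
    (χ₁ : (LocalRing L v)ˣ →* ℂˣ) (χ₂ : ↥(normOneUnits (conjLocal L (IsCMField.complexConj L) v)) →* ℂˣ)
    (h₁ : Continuous fun x => ((χ₁ x : ℂˣ) : ℂ)) (h₂ : Continuous fun x => ((χ₂ x : ℂˣ) : ℂ))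
    (hU : ∀ t : ↥(torusU (conjLocal L (IsCMField.complexConj L) v) (cmLocalForm L 3 v)),
      (t : ↥(unitaryGroupOfForm (conjLocal L (IsCMField.complexConj L) v) (cmLocalForm L 3 v))) ∈ cmLocalIntegralLevel L 3 (qsForm L) v → cmTorusCharPair L v χ₁ χ₂ t = 1)
    (N : Subrepresentation (cmPrincipalSeries L 3 v (cmTorusCharPair L v χ₁ χ₂))) (hbot : N ≠ ⊥) (htop : N ≠ ⊤) :
    haveI := locallyCompactSpace_cmBorelU L 3 v
    ∃ u : Representation.SmoothInd (cmBorelTriple L 3 v).P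
        (Representation.twist (((Representation.trivial ℂ ↥(torusU (conjLocal L (IsCMField.complexConj L) v) (cmLocalForm L 3 v)) ℂ).twist (cmTorusCharPair L v χ₁ χ₂)).comp
          (cmBorelTriple L 3 v).proj) (rootDeltaChar (cmBorelTriple L 3 v).P)),
      u ∈ N.toSubmodule ∧ u ∈ (cmPrincipalSeries L 3 v (cmTorusCharPair L v χ₁ χ₂)).fixedPoints I ∧ u ≠ 0 := by
  haveI := locallyCompactSpace_cmBorelU L 3 v
  -- the datum with `K 0 = I`
  obtain ⟨𝓘, h𝓘⟩ := exists_iwahoriDatum_K_zero_eq L v w hw eA heA hd g₁ hg₁ K0 K1 I hK0 hK1 hI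
  -- ★ N1: `r_B V` is a plane; smoothness; «no constituent has `r = 0`»
  obtain ⟨hfd, hX2, -⟩ := (UnitaryGroup.U3PrincipalSeriesJacquetFiltration_iff L).1
    (F0P3U3PrincipalSeriesJacquetFiltrationHolds.U3PrincipalSeriesJacquetFiltration_holds L) v hns χ₁ χ₂ h₁ h₂
  haveI := hfd
  have hsm : (cmPrincipalSeries L 3 v (cmTorusCharPair L v χ₁ χ₂)).IsSmooth := isSmooth_cmPrincipalSeries L v _
  have h1 : Module.finrank ℂ ((cmBorelTriple L 3 v).restrict N.toRepresentation).Coinvariants = 1 :=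
    Representation.finrank_coinvariants_eq_one_of_ne_bot_of_ne_top (cmBorelTriple L 3 v) (isLimitOfCompactOpen_cmBorelTriple_N L 3 v) hsm
      (fun c hc => by
        obtain ⟨r, rfl⟩ := IrrClass.mk_surjective c
        exact ⟨r, rfl, not_subsingleton_iff_nontrivial.mp fun h0 =>
          not_subsingleton_coinvariants_of_isConstituentOf_cmPrincipalSeries L v u3_isSupercuspidal_iff_jacquet_eq_zero_holds hns _ r hc h0⟩)
      hX2 hbot htop
  -- `T` acts on the line `r_B N` by `χ` (Frobenius), hence `T ∩ I` acts trivially in the unnormalised Jacquet module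
  have hJ := normalizedJacquet_apply_eq_smul_of_finrank_eq_one_of_intertwiningMap_cmPrincipalSeries L v _ _
    (hsm.toRepresentation N) h1 (Subrepresentation.subtypeIntertwiningMap N) (Subrepresentation.subtypeIntertwiningMap_ne_zero hbot)
  have hlev := isOpen_isCompact_levels L v w hw eA g₁ K0 K1 I hK0 hK1 hI
  have hIc : IsCompact (I : Set (Gqs L v)) := hlev.2.2.2
  have hfix := jacquetModule_apply_eq_self_of_normalizedJacquet_eq_smul (cmBorelTriple L 3 v) N.toRepresentation I (cmTorusCharPair L v χ₁ χ₂) hJ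
    (fun m hm => hU m ((mem_K0_iff_mem_integralLevel L v w hw eA heA K0 hK0 _).1 (I_le_K0 L v K0 K1 I hI hm)))
    (fun m hm => rootDeltaChar_borel_eq_one_of_mem_isCompact _ _ (cmLocalForm_eq_over L 3 v) hIc _ hm)
  -- admissibility of `N` and Jacquet's lemma at the Iwahori level
  have hadm := (isAdmissible_cmPrincipalSeries_of_iwasawa L 3 v (exists_borel_mul_mem_cmLocalIntegralLevel L 3 v)
    (cmTorusCharPair L v χ₁ χ₂)).toRepresentation N
  have key := exists_mem_fixedPoints_ne_zero_of_finrank_coinvariants_eq_one (cmBorelTriple L 3 v) 𝓘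
    (cmPrincipalSeries L 3 v (cmTorusCharPair L v χ₁ χ₂)) N hadm h1 (fun m hm => hfix m (h𝓘 ▸ hm))
  rw [h𝓘] at key
  exact key

end CM

end Summit.HodgeConjecture.HodgeConjecture.Cruxes.H413.K2E3IwahoriDetection

end
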